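import Summits.QuantumFields.YangMills.Theorems.UnitScaleTiltFluctuationComparisonRegPrGlobalSlackCanonicalPolymersCoreSplitV4
import Summits.QuantumFields.YangMills.Theorems.UnitScaleTiltFluctuationComparisonRegPrGlobalSlackKernelRescale
import Summits.QuantumFields.YangMills.Theorems.UnitScaleTiltFluctuationComparisonRegPrGlobalSlackCanonicalPolymersNewTermSplit
import HarnessLib

/-!
# `UnitScaleTiltFluctuationComparisonRegPrGlobalSlackCanonicalPolymersNewTermSplitV4` — THE v4 TWIN (★★OWNER RULING g26-№14 (F-2b); P22b polymer-step branch, width seat ym-ust-20520-w2 g4; skeleton v5kD; record-free decls imported from `…GlobalSlackCanonicalPolymersNewTermSplit`) of `…GlobalSlackCanonicalPolymersNewTermSplit` — THE NEWBORN-TERM TWO-RUN ROW SPLITS BY CHART FAMILY; THE STEP-CHART FAR TERMS ARE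
# DISCHARGED FROM THE DISPLAYED G3D-06 ROWS OF BOTH RUNS (crux `FluctuationComparisonRegPrIntL`, stmt-QuantumFields-20520, skeleton v5kC STUBS 3⁗χ / (i*)χ;
# width seat ym-ust-20520-w2 on (i*)χ — analytic rows)

WHY.  `…CanonicalPolymersCoreSplit` (this seat, p583765) reduced King's per-polymer row for the canonical term function to a NEWBORN-term row and an OLD-term row.  A newborn
term is, by definition (`newTermRows`), `(Re jet26(Ψ_X)(Bcfg_X) − far_X) + (Re jet26(Λ_X)(Bcfg_X) − farΛ_X)` — the step charts `Ψ = (𝔖 k).Ψ` (G3D-01, amplitude `C25·g_k`)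
and the g-free (63)-pieces `Λ = 𝔄.Λc k` (G3D-07, amplitude `C63`).  Of the four two-run differences, ONE is a theorem of the displayed rows in the registered currency: the
step-chart far terms, `|far′ − far| ≤ |far′| + |far|` with G3D-06 `far_le` of BOTH runs' step records (`|far_X| ≤ Cfar·C25·g_k·e^{−κ·dj X}·g_k⁷(r(g_k)p(g_k))⁷`), the spare
coupling paying print's collar polylogarithm (`g·r(g)⁷ ≤ M(7r₀, 1)`), `(g_kp(g_k))⁷ = θ(n+1)⁷ ≤ θ(n)⁷`, and the run-`K+1` letters matched (`gk_succ_eq`, `dj_domCast`).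

* §1 `g_mul_rFun_pow_le`, **`abs_farStepRows_le`** (one run: `|far_X(triv, W)| ≤ Cfar·C25·M·e^{−κ·dj X}·θ(K−k)⁷`), `abs_farStepRows_succ_le` (run `K+1` at the transported domain, SAME
  bound), **`abs_farStepRows_sub_le`** (two runs: `≤ 2·Cfar·C25·M·e^{−κ₁·dj X}·θ(n)⁷` for `κ₁ ≤ κ`, `√γ ≤ e^{1−p₀}`);
* §2 **`JetStepSlackOnRows S q b₀ p₀ κ₁ w a C`** (hypothesis schema: the two runs' RETAINED JETS of the step charts at their own configurations differ by a PURE RATE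
  `C·e^{−κ₁·dj X}·w(n)·L^{−a(1+k)}` — the K1a ∘ (44)-Cauchy content, [King1986] Prop. 3.6, on the displayed `Ψ`, `Bcfg`), **`LambdaTermSlackOnRows S q b₀ p₀ κ₁ w a σ C`** (the Λ-family
  newborn term `Re jet26(Λ_X)(Bcfg_X) − farΛ_X` compared across the runs — the located residual: the g-free family's far AND jet sizes carry `r(g)` and do not fit the registered
  `θ_{p₀}`-currency with an `n`-uniform constant, cell F-idea1-g15-1 / census 83–86; it rides as ONE row until a two-profile slack or an order-8 Λ-display is adopted);
* §3 **`newTermSlackOnRows_of_jetStep_lambda`**: `JetStepSlackOnRows … C_J ∧ LambdaTermSlackOnRows … 7 C_Λ ⟹ NewTermSlackOnRows S q 𝔠.b₀ 𝔠.p₀ κ₁ w a 7 (C_J + C_Λ + 2·Cfar·C25·M(7r₀,1))`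
  — the step far terms DISCHARGED.
UPSHOT for (i*)χ/3⁗χ (with p583765 + the polymer sockets p582974/p582987/p582522): the analytic input is `JetStepSlackOnRows` (two-run, displayed objects) + `LambdaTermSlackOnRows`
(located residual) + `OldTermSlackOnRows` ((M1)'s value row).  Nothing of [Balaban1985UV3]/[King1986] is asserted; no numerics; registry untouched (`--supports stmt-QuantumFields-20520`).
YM₃ on the torus is a rung of the ladder, not the Clay problem; nothing here is a claim about the crux or the gap.

References: T. Bałaban, CMP 102 (1985) 255–275 [Balaban1985UV3] ((7) p.257, (25) p.262, (33) p.264, (57) p.270, (59)–(63) pp.270–272, p.264 L15–16); C. King, CMP 102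
(1986) 649–677 [King1986] (Thm 3.4 (3.9) p.656, Prop. 3.6 (3.56) p.662).
-/

set_option autoImplicit false

noncomputable section

namespace Summit.QuantumFields.YangMills.Theorems.GlobalSlackCanonicalPolymers

open scoped BigOperators
open Finset
open Literature.MathematicalPhysics.QuantumFieldTheory.Balaban1983to89
open Literature.MathematicalPhysics.QuantumFieldTheory.Balaban1983to89.T3ContinuumYM3Torus
open Literature.MathematicalPhysics.QuantumFieldTheory.Balaban1983to89.T3UnitScaleTilt (θBal)
open Literature.MathematicalPhysics.QuantumFieldTheory.Balaban1983to89.T3LevelShift (fieldShift)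
open Literature.MathematicalPhysics.QuantumFieldTheory.Balaban1983to89.T3Thresholds (θBal_succ_le)
open Literature.MathematicalPhysics.QuantumFieldTheory.Balaban1983to89.T3AlphaInputsAC
open Literature.MathematicalPhysics.QuantumFieldTheory.Balaban1983to89.T3AlphaPolymerSocket
open Literature.MathematicalPhysics.QuantumFieldTheory.Balaban1983to89.T3AlphaInputsACTwoRunLevel
open Literature.MathematicalPhysics.QuantumFieldTheory.Balaban1983to89.TreeLengthTorus (tsys TPt)
open Literature.MathematicalPhysics.QuantumFieldTheory.Balaban1985CMP102
open Literature.MathematicalPhysics.QuantumFieldTheory.Balaban1985CMP102.Setting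
open Summit.QuantumFields.Balaban3D.Carriers
open Summit.QuantumFields.Balaban3D.Proofs.Primitives
open Summit.QuantumFields.Balaban3D.Proofs.Representation33 (jet26)
open Summit.QuantumFields.Balaban3D.Proofs.NewbornJet (rFun_pow)
open Summit.QuantumFields.Balaban3D.Proofs.ScalesArithmetic (gk_pos gk_le_one)
open Summit.QuantumFields.YangMills.Theorems
open Summit.QuantumFields.YangMills.Theorems.GlobalSlackKernelMatchingOn (WinPred)
open Summit.QuantumFields.YangMills.Theorems.GlobalSlackKernelRescale (logPowConst logPowConst_pos rpow_mul_logpow_le)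

variable {F : T3Family} {𝔠 : AlphaConsts F.L (suGroupModel 2).N} {γ : ℝ} {hγ : 0 < γ} {hγ1 : γ ≤ (min 𝔠.gamma0 1) ^ 2}

/-! ## §1 The step-chart far terms: one run, the other run, the two-run difference -/

-- (record-free `g_mul_rFun_pow_le`: imported from the v3 module, not restated)

/-- **ONE RUN: THE FAR TERMS OF THE STEP CHARTS ARE SEVENTH-ORDER SMALL IN THE REGISTERED CURRENCY** — from the displayed G3D-06 row `far_le` of the step record
(`|far_X(h,U)| ≤ Cfar·(C25·g_k·e^{−κ·dj X})·g_k⁷(r(g_k)p(g_k))⁷`): `|far_X(triv, W)| ≤ Cfar·C25·M(7r₀,1)·e^{−κ·dj X}·θ(K − k)⁷` (`g_kp(g_k) = θ(K−k)`, `g_k·r(g_k)⁷ ≤ M`).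
[cite: Balaban1985UV3, (57) p.270, p.264 L15-16, (7) p.257] -/
theorem abs_farStepRows_le (q : ∀ K, AlphaInputsT3AC.PkgCoreRows F 𝔠 γ hγ hγ1 K) (K k : ℕ) (hk : k + 1 ≤ K)
    (X : (tsys 3 (nblkOf (SK F 𝔠 γ hγ hγ1 K) 𝔠.lane.carrier k)).Dom) (W : GaugeField (F.P K) (k + 1) (Matrix.specialUnitaryGroup (Fin 2) ℂ)) :
    |((q K).𝔖 k).far X (Hist.triv (F.P K) (k + 1)) W| ≤
      𝔠.Cfar * 𝔠.C25 * logPowConst (7 * 𝔠.r₀) 1 * Real.exp (-(𝔠.κ * (tsys 3 (nblkOf (SK F 𝔠 γ hγ hγ1 K) 𝔠.lane.carrier k)).dj X)) *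
        θBal F.L γ 𝔠.b₀ 𝔠.p₀ (K - k) ^ 7 := by
  set g : ℝ := (SK F 𝔠 γ hγ hγ1 K).gk k with hgdef
  set pg : ℝ := B10.pFun 𝔠.b₀ 𝔠.p₀ g with hpgdef
  set r : ℝ := B10.rFun 𝔠.r₀ g with hrdef
  set e : ℝ := Real.exp (-(𝔠.κ * (tsys 3 (nblkOf (SK F 𝔠 γ hγ hγ1 K) 𝔠.lane.carrier k)).dj X)) with hedef
  have hg0 : 0 < g := gk_pos _ k
  have hg1 : g ≤ 1 := gk_le_one _ (SK F 𝔠 γ hγ hγ1 K).gK_le_one k (by show k ≤ K; omega)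
  have hpg0 : 0 ≤ pg := B10.pFun_nonneg _ _ _ 𝔠.b₀_pos.le hg0 hg1
  have he0 : 0 ≤ e := (Real.exp_pos _).le
  have hr : 0 ≤ 𝔠.r₀ := le_trans zero_le_one 𝔠.one_le_r₀
  have hfar : |((q K).𝔖 k).far X (Hist.triv (F.P K) (k + 1)) W| ≤ 𝔠.Cfar * ((𝔠.C25 * g * e) * (g ^ 7 * (r * pg) ^ 7)) :=
    ((q K).runRows.steps k hk).far_le X (Hist.triv (F.P K) (k + 1)) W
  have heps : g * pg = θBal F.L γ 𝔠.b₀ 𝔠.p₀ (K - k) := (q K).eps1_eq k (by omega)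
  have hM : g * r ^ 7 ≤ logPowConst (7 * 𝔠.r₀) 1 := g_mul_rFun_pow_le hr hg0 hg1
  have hcoef : 0 ≤ 𝔠.Cfar * 𝔠.C25 * e * (g * pg) ^ 7 := by
    have := 𝔠.Cfar_nonneg; have := 𝔠.C25_nonneg; positivity
  calc |((q K).𝔖 k).far X (Hist.triv (F.P K) (k + 1)) W|
      ≤ 𝔠.Cfar * ((𝔠.C25 * g * e) * (g ^ 7 * (r * pg) ^ 7)) := hfar
    _ = 𝔠.Cfar * 𝔠.C25 * e * (g * pg) ^ 7 * (g * r ^ 7) := by ring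
    _ ≤ 𝔠.Cfar * 𝔠.C25 * e * (g * pg) ^ 7 * logPowConst (7 * 𝔠.r₀) 1 := mul_le_mul_of_nonneg_left hM hcoef
    _ = 𝔠.Cfar * 𝔠.C25 * logPowConst (7 * 𝔠.r₀) 1 * e * θBal F.L γ 𝔠.b₀ 𝔠.p₀ (K - k) ^ 7 := by rw [← heps]; ring

/-- **THE OTHER RUN AT THE TRANSPORTED DOMAIN, SAME BOUND**: run `K+1`'s step-`(k+1)` far term at `domCast X` obeys the SAME inequality, indexed by run `K`'s letters
(`gk_succ_eq`: `g_{k+1}(K+1) = g_k(K)`; `dj_domCast`; `(K+1) − (k+1) = K − k`). [cite: Balaban1985UV3, (57) p.270, (39) p.266; Balaban1987RG1, (0.1) p.251] -/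
theorem abs_farStepRows_succ_le (q : ∀ K, AlphaInputsT3AC.PkgCoreRows F 𝔠 γ hγ hγ1 K) (K k : ℕ) (hk : k + 1 ≤ K)
    (X : (tsys 3 (nblkOf (SK F 𝔠 γ hγ hγ1 K) 𝔠.lane.carrier k)).Dom) (W' : GaugeField (F.P (K + 1)) (k + 1 + 1) (Matrix.specialUnitaryGroup (Fin 2) ℂ)) :
    |((q (K + 1)).𝔖 (k + 1)).far (domCast (nblkOf_succ_eq (hγ := hγ) (hγ1 := hγ1) K k) X) (Hist.triv (F.P (K + 1)) (k + 1 + 1)) W'| ≤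
      𝔠.Cfar * 𝔠.C25 * logPowConst (7 * 𝔠.r₀) 1 * Real.exp (-(𝔠.κ * (tsys 3 (nblkOf (SK F 𝔠 γ hγ hγ1 K) 𝔠.lane.carrier k)).dj X)) *
        θBal F.L γ 𝔠.b₀ 𝔠.p₀ (K - k) ^ 7 := by
  have h := abs_farStepRows_le q (K + 1) (k + 1) (by omega) (domCast (nblkOf_succ_eq (hγ := hγ) (hγ1 := hγ1) K k) X) W'
  rw [dj_domCast, show K + 1 - (k + 1) = K - k by omega] at h
  exact h

/-- **THE TWO-RUN DIFFERENCE OF THE STEP-CHART FAR TERMS IS `θ(n)⁷`-SLACK** (height `n`, `K − k = n + 1`; decay rate `κ₁ ≤ κ`; `√γ ≤ e^{1−p₀}` so that `θ(n+1) ≤ θ(n)`):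
`|far′_{domCast X}(triv, W′) − far_X(triv, W)| ≤ 2·Cfar·C25·M(7r₀,1)·e^{−κ₁·dj X}·θ(n)⁷` — a theorem of the two runs' displayed G3D-06 rows; no comparison of the far terms is
needed or claimed. [cite: Balaban1985UV3, (57) p.270, (7) p.257; King1986, Thm 3.4 (3.9) p.656] -/
theorem abs_farStepRows_sub_le (q : ∀ K, AlphaInputsT3AC.PkgCoreRows F 𝔠 γ hγ hγ1 K) {κ₁ : ℝ} (hκ₁ : κ₁ ≤ 𝔠.κ)
    (hγe : Real.sqrt γ ≤ Real.exp (1 - 𝔠.p₀)) (K n k : ℕ) (hk : K - n = k + 1) (hkK : k + 1 ≤ K)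
    (X : (tsys 3 (nblkOf (SK F 𝔠 γ hγ hγ1 K) 𝔠.lane.carrier k)).Dom)
    (W : GaugeField (F.P K) (k + 1) (Matrix.specialUnitaryGroup (Fin 2) ℂ)) (W' : GaugeField (F.P (K + 1)) (k + 1 + 1) (Matrix.specialUnitaryGroup (Fin 2) ℂ)) :
    |((q (K + 1)).𝔖 (k + 1)).far (domCast (nblkOf_succ_eq (hγ := hγ) (hγ1 := hγ1) K k) X) (Hist.triv (F.P (K + 1)) (k + 1 + 1)) W' -
        ((q K).𝔖 k).far X (Hist.triv (F.P K) (k + 1)) W| ≤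
      2 * (𝔠.Cfar * 𝔠.C25 * logPowConst (7 * 𝔠.r₀) 1) * Real.exp (-κ₁ * (tsys 3 (nblkOf (SK F 𝔠 γ hγ hγ1 K) 𝔠.lane.carrier k)).dj X) *
        θBal F.L γ 𝔠.b₀ 𝔠.p₀ n ^ 7 := by
  have hL : 1 ≤ F.L := F.hL.2.le
  have hγ1' : γ ≤ 1 := hγ1.trans (sq_min_one_le _ 𝔠.gamma0_pos)
  have hKk : K - k = n + 1 := by omega
  have h1 := abs_farStepRows_succ_le q K k hkK X W'
  have h0 := abs_farStepRows_le q K k hkK X W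
  rw [hKk] at h0 h1
  -- weaken the decay rate and the threshold height
  set d : ℝ := (tsys 3 (nblkOf (SK F 𝔠 γ hγ hγ1 K) 𝔠.lane.carrier k)).dj X with hddef
  have hd : 0 ≤ d := (tsys 3 (nblkOf (SK F 𝔠 γ hγ hγ1 K) 𝔠.lane.carrier k)).dj_nonneg X
  have hexp : Real.exp (-(𝔠.κ * d)) ≤ Real.exp (-κ₁ * d) := Real.exp_le_exp.mpr (by nlinarith)
  have hθ0 : 0 ≤ θBal F.L γ 𝔠.b₀ 𝔠.p₀ (n + 1) := (T3MinimiserStabilityReduction.θBal_pos hL hγ hγ1' 𝔠.b₀_pos 𝔠.p₀ (n + 1)).le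
  have hθ : θBal F.L γ 𝔠.b₀ 𝔠.p₀ (n + 1) ^ 7 ≤ θBal F.L γ 𝔠.b₀ 𝔠.p₀ n ^ 7 :=
    pow_le_pow_left₀ hθ0 (θBal_succ_le hL hγ hγ1' hγe 𝔠.b₀_pos.le 𝔠.p₀_pos.le n) 7
  have hA : 0 ≤ 𝔠.Cfar * 𝔠.C25 * logPowConst (7 * 𝔠.r₀) 1 := by
    have := 𝔠.Cfar_nonneg; have := 𝔠.C25_nonneg
    have := (logPowConst_pos (q := 7 * 𝔠.r₀) (c := 1) (by linarith [𝔠.one_le_r₀]) one_pos).le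
    positivity
  have hone : 𝔠.Cfar * 𝔠.C25 * logPowConst (7 * 𝔠.r₀) 1 * Real.exp (-(𝔠.κ * d)) * θBal F.L γ 𝔠.b₀ 𝔠.p₀ (n + 1) ^ 7 ≤
      𝔠.Cfar * 𝔠.C25 * logPowConst (7 * 𝔠.r₀) 1 * Real.exp (-κ₁ * d) * θBal F.L γ 𝔠.b₀ 𝔠.p₀ n ^ 7 :=
    mul_le_mul (mul_le_mul_of_nonneg_left hexp hA) hθ (pow_nonneg hθ0 7) (mul_nonneg hA (Real.exp_pos _).le)
  calc |_ - _| ≤ |((q (K + 1)).𝔖 (k + 1)).far (domCast (nblkOf_succ_eq (hγ := hγ) (hγ1 := hγ1) K k) X) (Hist.triv (F.P (K + 1)) (k + 1 + 1)) W'| +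
        |((q K).𝔖 k).far X (Hist.triv (F.P K) (k + 1)) W| := abs_sub _ _
    _ ≤ _ + _ := add_le_add (h1.trans hone) (h0.trans hone)
    _ = _ := by ring

/-! ## §2 The jet row of the step charts and the Λ-family row (hypothesis schemas) -/

/-- **THE TWO-RUN ROW FOR THE RETAINED JETS OF THE STEP CHARTS** (hypothesis schema, never asserted): at every lattice level `K − n = k + 1`, every doubly-`S`-good window datum
`V` and every retained domain `X` of step `k`, the retained jet `Re jet26(Ψ′_{domCast X})(Bcfg′_{domCast X}(triv, V↑))` of run `K+1`'s step-`(k+1)` chart minus run `K`'s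
`Re jet26(Ψ_X)(Bcfg_X(triv, V↑))`, up to a datum-independent shift, is a PURE RATE `C·e^{−κ₁·dj X}·w(n)·L^{−a(1+k)}` — King's flat-kernel comparison composed with the
configuration comparison ([King1986] Prop. 3.6 (3.56) with Prop. 3.9 (3.71)), stated on the DISPLAYED `Ψ = (𝔖 k).Ψ`, `Bcfg` of the two step records.
[cite: King1986, Prop. 3.6 (3.56) p.662, Prop. 3.9 (3.71) p.665; Balaban1985UV3, (33) p.264, (59)-(60) pp.270-271, (47) p.267] -/
def JetStepSlackOnRows (S : WinPred F) (q : ∀ K, AlphaInputsT3AC.PkgCoreRows F 𝔠 γ hγ hγ1 K) (b₀ p₀ κ₁ : ℝ) (w : ℕ → ℝ) (a C : ℝ) : Prop :=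
  ∃ c : (K k : ℕ) → (tsys 3 (nblkOf (SK F 𝔠 γ hγ hγ1 K) 𝔠.lane.carrier k)).Dom → ℝ,
    ∀ (K n : ℕ) (h : n ≤ K) (k : ℕ) (hk : K - n = k + 1),
      ∀ V : GaugeField (F.P n) 0 (Matrix.specialUnitaryGroup (Fin 2) ℂ), PlaqSmall (θBal F.L γ b₀ p₀ n) V →
        S K n h V → S (K + 1) n (h.trans (Nat.le_succ K)) V →
        ∀ X ∈ newDomsRows q K k (Hist.triv (F.P K) (k + 1)),
          |(jet26 (((q (K + 1)).𝔖 (k + 1)).Ψ (domCast (nblkOf_succ_eq (hγ := hγ) (hγ1 := hγ1) K k) X))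
                (((q (K + 1)).𝔖 (k + 1)).Bcfg (domCast (nblkOf_succ_eq (hγ := hγ) (hγ1 := hγ1) K k) X) (Hist.triv (F.P (K + 1)) (k + 1 + 1))
                  (fieldShift (F.sitesPerDir_eq (m := F.m) (K := K + 1) (j := k + 1 + 1) (m' := F.m) (K' := n) (j' := 0) (by omega)) V))).re -
            (jet26 (((q K).𝔖 k).Ψ X)
                (((q K).𝔖 k).Bcfg X (Hist.triv (F.P K) (k + 1))
                  (fieldShift (F.sitesPerDir_eq (m := F.m) (K := K) (j := k + 1) (m' := F.m) (K' := n) (j' := 0) (by omega)) V))).re -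
            c K k X| ≤
          C * Real.exp (-κ₁ * (tsys 3 (nblkOf (SK F 𝔠 γ hγ hγ1 K) 𝔠.lane.carrier k)).dj X) * (w n * (((F.L : ℝ) ^ (1 + k))⁻¹) ^ a)

/-- **THE TWO-RUN ROW FOR THE Λ-FAMILY NEWBORN TERMS** (hypothesis schema, never asserted; the LOCATED RESIDUAL): the (63)-pieces' retained jet minus far term,
`Re jet26(Λ_X)(Bcfg_X) − farΛ_X` (`Λ = 𝔄.Λc k`, G3D-07, g-free amplitude `C63`), compared across the runs at matched domains and fields, budget `C·e^{−κ₁·dj X}·(w(n)·L^{−a(1+k)}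
+ θ(n)^σ)`.  Its displayed sizes (`Λc.far_le`: `θ(n+1)⁷·r(g)⁷`; `bound28` inside the g-free jet: `r(g)` per leg) exceed the registered `θ_{p₀}`-currency by collar polylogarithms that
no spare coupling pays (cell F-idea1-g15-1), so no part of it is discharged here. [cite: Balaban1985UV3, (61)-(63) pp.271-272, p.265 L13-15, (57) p.270; King1986, Thm 3.4 (3.9) p.656] -/
def LambdaTermSlackOnRows (S : WinPred F) (q : ∀ K, AlphaInputsT3AC.PkgCoreRows F 𝔠 γ hγ hγ1 K) (b₀ p₀ κ₁ : ℝ) (w : ℕ → ℝ) (a : ℝ) (σ : ℕ) (C : ℝ) : Prop :=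
  ∃ c : (K k : ℕ) → (tsys 3 (nblkOf (SK F 𝔠 γ hγ hγ1 K) 𝔠.lane.carrier k)).Dom → ℝ,
    ∀ (K n : ℕ) (h : n ≤ K) (k : ℕ) (hk : K - n = k + 1),
      ∀ V : GaugeField (F.P n) 0 (Matrix.specialUnitaryGroup (Fin 2) ℂ), PlaqSmall (θBal F.L γ b₀ p₀ n) V →
        S K n h V → S (K + 1) n (h.trans (Nat.le_succ K)) V →
        ∀ X ∈ newDomsRows q K k (Hist.triv (F.P K) (k + 1)),
          |((jet26 (((q (K + 1)).𝔄.Λc (k + 1)).Ψ (domCast (nblkOf_succ_eq (hγ := hγ) (hγ1 := hγ1) K k) X))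
                (((q (K + 1)).𝔖 (k + 1)).Bcfg (domCast (nblkOf_succ_eq (hγ := hγ) (hγ1 := hγ1) K k) X) (Hist.triv (F.P (K + 1)) (k + 1 + 1))
                  (fieldShift (F.sitesPerDir_eq (m := F.m) (K := K + 1) (j := k + 1 + 1) (m' := F.m) (K' := n) (j' := 0) (by omega)) V))).re -
              ((q (K + 1)).𝔄.Λc (k + 1)).far (domCast (nblkOf_succ_eq (hγ := hγ) (hγ1 := hγ1) K k) X) (Hist.triv (F.P (K + 1)) (k + 1 + 1))
                (fieldShift (F.sitesPerDir_eq (m := F.m) (K := K + 1) (j := k + 1 + 1) (m' := F.m) (K' := n) (j' := 0) (by omega)) V)) -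
            ((jet26 (((q K).𝔄.Λc k).Ψ X)
                (((q K).𝔖 k).Bcfg X (Hist.triv (F.P K) (k + 1))
                  (fieldShift (F.sitesPerDir_eq (m := F.m) (K := K) (j := k + 1) (m' := F.m) (K' := n) (j' := 0) (by omega)) V))).re -
              ((q K).𝔄.Λc k).far X (Hist.triv (F.P K) (k + 1))
                (fieldShift (F.sitesPerDir_eq (m := F.m) (K := K) (j := k + 1) (m' := F.m) (K' := n) (j' := 0) (by omega)) V)) -
            c K k X| ≤
          C * Real.exp (-κ₁ * (tsys 3 (nblkOf (SK F 𝔠 γ hγ hγ1 K) 𝔠.lane.carrier k)).dj X) *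
            (w n * (((F.L : ℝ) ^ (1 + k))⁻¹) ^ a + θBal F.L γ b₀ p₀ n ^ σ)

/-! ## §3 The newborn row from the jet row and the Λ row, the step far terms discharged -/

/-- Triangle bookkeeping for the newborn difference: if `T′ − T − c = x + y − z` then `|T′ − T − c| ≤ A + B + C` from `|x| ≤ A`, `|y| ≤ B`, `|z| ≤ C`. [folklore] -/
private theorem three_terms {T T' c x y z A B C : ℝ} (hT : T' - T - c = x + y - z) (hx : |x| ≤ A) (hy : |y| ≤ B) (hz : |z| ≤ C) :
    |T' - T - c| ≤ A + B + C := by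
  rw [hT]
  calc |x + y - z| ≤ |x + y| + |z| := abs_sub _ _
    _ ≤ (|x| + |y|) + |z| := by gcongr; exact abs_add_le x y
    _ ≤ A + B + C := by linarith

/-- **THE NEWBORN-TERM ROW FROM THE STEP-JET ROW AND THE Λ ROW — THE STEP FAR TERMS DISCHARGED** (registered currency: the record's profile, `σ = 7`; decay rate `κ₁ ≤ 𝔠.κ`;
`√γ ≤ e^{1−p₀}`; weight `w ≥ 0`, `C_J ≥ 0`): `JetStepSlackOnRows S q b₀ p₀ κ₁ w a C_J ∧ LambdaTermSlackOnRows S q b₀ p₀ κ₁ w a 7 C_Λ ⟹ NewTermSlackOnRows S q b₀ p₀ κ₁ w a 7 (C_J + C_Λ + 2·Cfar·C25·M(7r₀,1))`,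
the third summand being §1's two-run bound on the step far terms from the displayed G3D-06 rows. [cite: King1986, Thm 3.4 (3.9) p.656, Prop. 3.6 (3.56) p.662; Balaban1985UV3, (33) p.264, (57) p.270, (59)-(63) pp.270-272] -/
theorem newTermSlackOnRows_of_jetStep_lambda (S : WinPred F) (q : ∀ K, AlphaInputsT3AC.PkgCoreRows F 𝔠 γ hγ hγ1 K) {κ₁ a C_J C_Λ : ℝ} {w : ℕ → ℝ}
    (hκ₁ : κ₁ ≤ 𝔠.κ) (hγe : Real.sqrt γ ≤ Real.exp (1 - 𝔠.p₀)) (hw : ∀ n, 0 ≤ w n) (hCJ : 0 ≤ C_J)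
    (hJ : JetStepSlackOnRows S q 𝔠.b₀ 𝔠.p₀ κ₁ w a C_J) (hΛ : LambdaTermSlackOnRows S q 𝔠.b₀ 𝔠.p₀ κ₁ w a 7 C_Λ) :
    NewTermSlackOnRows S q 𝔠.b₀ 𝔠.p₀ κ₁ w a 7 (C_J + C_Λ + 2 * (𝔠.Cfar * 𝔠.C25 * logPowConst (7 * 𝔠.r₀) 1)) := by
  obtain ⟨cJ, hcJ⟩ := hJ
  obtain ⟨cΛ, hcΛ⟩ := hΛ
  have hL : 1 ≤ F.L := F.hL.2.le
  have hL0 : (0 : ℝ) < (F.L : ℝ) := by exact_mod_cast (zero_lt_one.trans F.hL.2)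
  have hγ1' : γ ≤ 1 := hγ1.trans (sq_min_one_le _ 𝔠.gamma0_pos)
  have hF : 0 ≤ 𝔠.Cfar * 𝔠.C25 * logPowConst (7 * 𝔠.r₀) 1 := by
    have := 𝔠.Cfar_nonneg; have := 𝔠.C25_nonneg
    have := (logPowConst_pos (q := 7 * 𝔠.r₀) (c := 1) (by linarith [𝔠.one_le_r₀]) one_pos).le
    positivity
  refine ⟨fun K k X => cJ K k X + cΛ K k X, fun K n hn k hk V hV hS hS' X hX => ?_⟩
  have hkK : k + 1 ≤ K := by omega
  have hj := hcJ K n hn k hk V hV hS hS' X hX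
  have hl := hcΛ K n hn k hk V hV hS hS' X hX
  have hf := abs_farStepRows_sub_le q hκ₁ hγe K n k hk hkK X
    (fieldShift (F.sitesPerDir_eq (m := F.m) (K := K) (j := k + 1) (m' := F.m) (K' := n) (j' := 0) (by omega)) V)
    (fieldShift (F.sitesPerDir_eq (m := F.m) (K := K + 1) (j := k + 1 + 1) (m' := F.m) (K' := n) (j' := 0) (by omega)) V)
  -- letters of the budget
  set e : ℝ := Real.exp (-κ₁ * (tsys 3 (nblkOf (SK F 𝔠 γ hγ hγ1 K) 𝔠.lane.carrier k)).dj X) with hedef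
  set ρw : ℝ := w n * (((F.L : ℝ) ^ (1 + k))⁻¹) ^ a with hρdef
  set t : ℝ := θBal F.L γ 𝔠.b₀ 𝔠.p₀ n ^ 7 with htdef
  have he : 0 ≤ e := (Real.exp_pos _).le
  have hρw : 0 ≤ ρw := mul_nonneg (hw n) (Real.rpow_nonneg (by positivity) _)
  have ht : 0 ≤ t := pow_nonneg (T3MinimiserStabilityReduction.θBal_pos hL hγ hγ1' 𝔠.b₀_pos 𝔠.p₀ n).le 7
  -- regroup with the rows' own atoms (the field-shift proofs of the three rows differ only by proof irrelevance)
  have hT : ∀ (jΨ jΨ' f f' jΛ jΛ' g g' dJ dΛ : ℝ),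
      (jΨ' - f') + (jΛ' - g') - ((jΨ - f) + (jΛ - g)) - (dJ + dΛ) = (jΨ' - jΨ - dJ) + ((jΛ' - g') - (jΛ - g) - dΛ) - (f' - f) := by
    intros; ring
  refine (three_terms (hT _ _ _ _ _ _ _ _ _ _) hj hl hf).trans ?_
  have h1 : 0 ≤ C_J * e * t := mul_nonneg (mul_nonneg hCJ he) ht
  have h2 : 0 ≤ 2 * (𝔠.Cfar * 𝔠.C25 * logPowConst (7 * 𝔠.r₀) 1) * e * ρw := mul_nonneg (mul_nonneg (by positivity) he) hρw
  nlinarith [h1, h2]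

end Summit.QuantumFields.YangMills.Theorems.GlobalSlackCanonicalPolymers

end
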